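import Summits.Ventures.PercRepro.MSTightHalfExcess
import Summits.Ventures.PercRepro.MSTightConjTCorollaries
import Summits.Ventures.PercRepro.MSTightExcessOneComplex
import Summits.Ventures.PercRepro.ExcessOneProjection

/-!
# The completion dichotomy (H3) is a theorem — twin-free form

Dossier proofs/MINE1-theoremS.md, Addendum 57. At a tightening direction `r` of a twin-free
family `F` of Marica–Schönheim excess one with `∅, univ ∉ F`, empty core and full support, one of
the two one-sided completions `completion0 r F = F₀ ∪ (P + r)` and `completion1 r F = P ∪ (F₁ + r)`
is tight. This is the candidate Prop `CompletionDichotomy α` of MSTightConjTCompletion.lean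
(Addendum 46) in the twin-free setting, never asserted until now.

The proof is a three-line count on top of Theorem (T) and Theorem (YD), both in the tree:
* `|Y| = |K| + 1` and `Y ⊆ D(P)` (`card_diffsY_of_genuine`, from `conjT`), so the lost
  differences `Λ := D(P) ∖ Y` number `|P| − |K| − 1 = |P₀| + |P₁| − 1`;
* the lost differences realised as `p ∖ s` (`p ∈ P`, `s ∈ F₀`) and those realised as `t ∖ q`
  (`t ∈ F₁`, `q ∈ P`) are DISJOINT: `w = p ∖ s = t ∖ q` gives `w ⊆ t ∖ s ∈ Y`, and `Y` is a
  down-set (`isDownSet_diffs_of_genuine`), so `w ∈ Y`;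
* hence `|P \\ F₀| + |F₁ \\ P| ≤ |F₀| + |F₁| + 1`, and `|P \\ F₀| ≤ |F₀|` makes `completion0 r F`
  tight (its `r`-free differences lie in `D(P)`, its `r`-differences are `P \\ F₀`, and
  `|completion0 r F| = |F₀| + |P|`), mirror for `completion1 r F`.

The exact structure of the completions (`part0_completion0`, `partr_completion0`,
`card_completion0`, `card_diffs_completion0` and the mirrors) is in MSTightCompletion0Lost.lean /
MSTightCompletionLost.lean / MSTightHalfExcess.lean (gen 25); the two tightness criteria
`tight_completion0_of_card_le`, `tight_completion1_of_card_le` are the converses of the counting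
lemmas of MSTightConjTCompletion.lean.
-/

namespace PercRepro.MSTight

open Finset
open scoped FinsetFamily

variable {α : Type*} [DecidableEq α] {r : α} {F : Finset (Finset α)}

section Criteria

/-- **Tightness criterion for `completion0`:** with a tight trace, `|P \\ F₀| ≤ |F₀|` makes
`F₀ ∪ (P + r)` tight (the converse of `card_diffs_proj_part0_le_of_tight_completion0`). -/
theorem tight_completion0_of_card_le (hP : Tight (proj r F))
    (h : (proj r F \\ part0 r F).card ≤ (part0 r F).card) : Tight (completion0 r F) := by
  apply le_antisymm _ (card_le_card_diffs _)
  rw [card_diffs_completion0, card_completion0]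
  have hP' : (proj r F \\ proj r F).card = (proj r F).card := hP
  omega

/-- **Tightness criterion for `completion1`:** with a tight trace, `|F₁ \\ P| ≤ |F₁|` makes
`P ∪ (F₁ + r)` tight. -/
theorem tight_completion1_of_card_le (hP : Tight (proj r F))
    (h : (partr r F \\ proj r F).card ≤ (partr r F).card) : Tight (completion1 r F) := by
  apply le_antisymm _ (card_le_card_diffs _)
  rw [card_diffs_completion1, card_completion1]
  have hP' : (proj r F \\ proj r F).card = (proj r F).card := hP
  omega

end Criteria

section Main

variable [Fintype α]

/-- **`Y` is a down-set** for a twin-free genuine excess-one family, at every direction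
(Theorem (YD) read on the type-I differences). -/
theorem mem_diffsY_of_subset_of_genuine (htw : ∀ a b, Twin F a b → a = b)
    (hF : (F \\ F).card = F.card + 1) (hE : (∅ : Finset α) ∉ F) (hU : (univ : Finset α) ∉ F)
    (hcore : ∀ a, ∃ t ∈ F, a ∉ t) (hsupp : ∀ a, ∃ t ∈ F, a ∈ t) {y : Finset α}
    (hy : y ∈ diffsY r F) {z : Finset α} (hz : z ⊆ y) : z ∈ diffsY r F := by
  have hD := isDownSet_diffs_of_genuine htw hF hE hU hcore hsupp
  obtain ⟨hry, hy'⟩ := mem_diffsY_iff.1 hy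
  exact mem_diffsY_iff.2 ⟨fun hrz => hry (hz hrz), hD _ hy' _ (insert_subset_insert r hz)⟩

/-- **THE COMPLETION DICHOTOMY (H3), twin-free form.** At a tightening direction `r` of a
twin-free family of Marica–Schönheim excess one with `∅, univ ∉ F`, empty core and full support,
`F₀ ∪ (P + r)` or `P ∪ (F₁ + r)` is tight. Proof: `Y ⊆ D(P)` with `|Y| = |K| + 1`; the
`r`-differences `P \\ F₀` of the first completion and `F₁ \\ P` of the second both contain `Y`,
and their parts outside `Y` are disjoint subsets of `D(P) ∖ Y` (a common element `p ∖ s = t ∖ q`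
lies inside `t ∖ s ∈ Y`, and `Y` is a down-set); so
`|P \\ F₀| + |F₁ \\ P| ≤ |P| + |K| + 1 = |F₀| + |F₁| + 1`, and the tightness criteria close. -/
theorem completion_dichotomy_of_twinFree (htw : ∀ a b, Twin F a b → a = b)
    (hF : (F \\ F).card = F.card + 1) (hE : (∅ : Finset α) ∉ F) (hU : (univ : Finset α) ∉ F)
    (hcore : ∀ a, ∃ t ∈ F, a ∉ t) (hsupp : ∀ a, ∃ t ∈ F, a ∈ t) (hP : Tight (proj r F)) :
    Tight (completion0 r F) ∨ Tight (completion1 r F) := by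
  -- `Y` inside the two `r`-difference families, all inside `D(P)`
  have hYA : diffsY r F ⊆ proj r F \\ part0 r F :=
    diffs_subset_right partr_subset_proj_completion
  have hYB : diffsY r F ⊆ partr r F \\ proj r F :=
    diffs_subset_left part0_subset_proj_completion
  have hA : proj r F \\ part0 r F ⊆ proj r F \\ proj r F :=
    diffs_subset_left part0_subset_proj_completion
  have hB : partr r F \\ proj r F ⊆ proj r F \\ proj r F :=
    diffs_subset_right partr_subset_proj_completion
  -- the lost differences of the two kinds are disjoint
  have hdisj : Disjoint ((proj r F \\ part0 r F) \ diffsY r F)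
      ((partr r F \\ proj r F) \ diffsY r F) := by
    rw [disjoint_left]
    intro w hw hw'
    obtain ⟨hwA, hwY⟩ := mem_sdiff.1 hw
    obtain ⟨hwB, -⟩ := mem_sdiff.1 hw'
    obtain ⟨p, -, s, hs, hps⟩ := mem_diffs.1 hwA
    obtain ⟨t, ht, q, -, htq⟩ := mem_diffs.1 hwB
    apply hwY
    have hts : t \ s ∈ diffsY r F := mem_diffs.2 ⟨t, ht, s, hs, rfl⟩
    refine mem_diffsY_of_subset_of_genuine htw hF hE hU hcore hsupp hts ?_
    intro x hx
    have hx1 : x ∈ t \ q := by rw [htq]; exact hx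
    have hx2 : x ∈ p \ s := by rw [hps]; exact hx
    exact mem_sdiff.2 ⟨(mem_sdiff.1 hx1).1, (mem_sdiff.1 hx2).2⟩
  -- the counts
  have hY : (diffsY r F).card = (partner r F).card + 1 :=
    card_diffsY_of_genuine hF hE hU hcore hsupp hP
  have hPP : (proj r F \\ proj r F).card = (proj r F).card := hP
  have hPK : (proj r F).card + (partner r F).card = (part0 r F).card + (partr r F).card := by
    have h := card_union_add_card_inter (part0 r F) (partr r F)
    rw [← proj_eq_union] at h
    exact h
  have h1 : ((proj r F \\ part0 r F) \ diffsY r F).card + (diffsY r F).card =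
      (proj r F \\ part0 r F).card := card_sdiff_add_card_eq_card hYA
  have h2 : ((partr r F \\ proj r F) \ diffsY r F).card + (diffsY r F).card =
      (partr r F \\ proj r F).card := card_sdiff_add_card_eq_card hYB
  have h3 : ((proj r F \\ part0 r F) \ diffsY r F ∪ (partr r F \\ proj r F) \ diffsY r F).card =
      ((proj r F \\ part0 r F) \ diffsY r F).card + ((partr r F \\ proj r F) \ diffsY r F).card :=
    card_union_of_disjoint hdisj
  have h4 : (proj r F \\ part0 r F) \ diffsY r F ∪ (partr r F \\ proj r F) \ diffsY r F ⊆
      (proj r F \\ proj r F) \ diffsY r F := by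
    apply union_subset
    · exact sdiff_subset_sdiff hA (Subset.refl _)
    · exact sdiff_subset_sdiff hB (Subset.refl _)
  have h5 : ((proj r F \\ proj r F) \ diffsY r F).card + (diffsY r F).card =
      (proj r F \\ proj r F).card := card_sdiff_add_card_eq_card (hYA.trans hA)
  have h6 := card_le_card h4
  -- conclusion
  by_contra hcon
  obtain ⟨hc0, hc1⟩ := not_or.1 hcon
  have hA' : (part0 r F).card < (proj r F \\ part0 r F).card := by
    by_contra h
    exact hc0 (tight_completion0_of_card_le hP (not_lt.1 h))
  have hB' : (partr r F).card < (partr r F \\ proj r F).card := by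
    by_contra h
    exact hc1 (tight_completion1_of_card_le hP (not_lt.1 h))
  omega

end Main

end PercRepro.MSTight
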